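import Summits.ABC.ABC.Theorems.ModerateWindowCount.Negative.Window
import Summits.ABC.ABC.Theorems.ModerateWindowCount.Negative.TwistFamily

/-!
# `ModerateWindowCount` (stmt-ABC-1973) — negative-side lemmas III: window membership of the twists,
# counting tools, prime supply

Standing-adversary (cdisprove) output. `tf_mem_window_six`: membership of `tf α k` in the window `[κ, 6]` at
scale `X` from the two ratio conditions in logarithmic form (`N = d² r₀`, `r₀ = p · rad k`, `M⁺ = d⁶ m³`);
`αOf`, `tf_αOf_injOn` (read `d` off `c₄ = d² m`), `pow_four_mul_mod_sixteen`, the exponent choice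
`sixSharp_exponents` (`j = 4i` with `δ < e_j = ((6−κ)j − κ)/(6(j−1))`), the complement count
`card_primesIoc_le_filter_add` and the `log m` bounds `log_mOf_bounds`.
Refuter seat refuter-cdisprove-stmt-ABC-1973-0, 2026-08-16.
-/

namespace Summit.ABC.ABC.Theorems.ModerateWindowCount.Negative

open Summit.ABC.ABC.Theses.TwistAmplification WeierstrassCurve IsDedekindDomain
open Summit.ABC.ABC.Theorems.SomeWindowSaving.Negative

noncomputable section

/-! ### 4.3 Window membership (log form) and the labelling `αOf` -/

section Membership

variable {p j k d : ℕ} {α : ℤ}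

/-- `m = 256k² + 16k + 1 = q² − q + 1`. [folklore] -/
def mOf (k : ℕ) : ℕ := 256 * k ^ 2 + 16 * k + 1

/-- Cast of `mOf` to `ℤ`. [folklore] -/
theorem mOf_cast (k : ℕ) : ((mOf k : ℕ) : ℤ) = 256 * (k : ℤ) ^ 2 + 16 * k + 1 := by
  simp [mOf]

/-- `0 < mOf k`. [folklore] -/
theorem mOf_pos (k : ℕ) : 0 < mOf k := by unfold mOf; positivity

/-- `M⁺ (tf α k) = d⁶ m³` (the `c₄³` term dominates). [folklore] -/
theorem tf_maxInv (hα : 4 * α - 1 = d ∨ 4 * α - 1 = -(d : ℤ)) :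
    max |(tf α (k : ℤ)).Δ| (|(tf α (k : ℤ)).c₄| ^ 3) = (d : ℤ) ^ 6 * ((mOf k : ℕ) : ℤ) ^ 3 := by
  rw [tf_Δ, tf_c₄, D_pow_six hα, D_sq hα, mOf_cast]
  set m' : ℤ := 256 * (k : ℤ) ^ 2 + 16 * k + 1 with hm'
  have hm'1 : 1 ≤ m' := by
    have : (0 : ℤ) ≤ 256 * (k : ℤ) ^ 2 + 16 * k := by positivity
    rw [hm']; linarith
  have hk0 : (0 : ℤ) ≤ k := by positivity
  have hd0 : (0 : ℤ) ≤ (d : ℤ) ^ 6 := by positivity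
  have hc : |(d : ℤ) ^ 2 * m'| ^ 3 = (d : ℤ) ^ 6 * m' ^ 3 := by
    rw [abs_of_nonneg (by positivity)]; ring
  have hΔ : |(d : ℤ) ^ 6 * (k : ℤ) ^ 2 * (16 * k + 1) ^ 2| = (d : ℤ) ^ 6 * ((k : ℤ) * (16 * k + 1)) ^ 2 := by
    rw [abs_of_nonneg (by positivity)]; ring
  rw [hc, hΔ]
  apply max_eq_right
  apply mul_le_mul_of_nonneg_left _ hd0
  have h1 : (k : ℤ) * (16 * k + 1) ≤ m' := by rw [hm']; nlinarith
  have h2 : (0 : ℤ) ≤ (k : ℤ) * (16 * k + 1) := by positivity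
  calc ((k : ℤ) * (16 * k + 1)) ^ 2 ≤ m' ^ 2 := pow_le_pow_left₀ h2 h1 2
    _ ≤ m' ^ 3 := pow_le_pow_right₀ hm'1 (by norm_num)

/-- `c₄ (tf α k) ≠ 0` (no CM by `j = 0`). [folklore] -/
theorem tf_c₄_ne_zero (hd : d.Prime) (hα : 4 * α - 1 = d ∨ 4 * α - 1 = -(d : ℤ)) :
    (tf α (k : ℤ)).c₄ ≠ 0 := by
  rw [tf_c₄]
  have h1 := D_ne_zero hd hα
  have h2 : (256 * (k : ℤ) ^ 2 + 16 * k + 1) ≠ 0 := by positivity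
  positivity

/-- `c₆ (tf α k) ≠ 0` (no CM by `j = 1728`). [folklore] -/
theorem tf_c₆_ne_zero (hk : k ≠ 0) (hd : d.Prime) (hα : 4 * α - 1 = d ∨ 4 * α - 1 = -(d : ℤ)) :
    (tf α (k : ℤ)).c₆ ≠ 0 := by
  rw [tf_c₆, neg_ne_zero]
  have h1 := D_ne_zero hd hα
  have hk1 : (1 : ℤ) ≤ k := by exact_mod_cast Nat.one_le_iff_ne_zero.mpr hk
  have h2 : (16 * (k : ℤ) - 1) ≠ 0 := by omega
  have h3 : (8 * (k : ℤ) + 1) ≠ 0 := by omega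
  have h4 : (32 * (k : ℤ) + 1) ≠ 0 := by omega
  exact mul_ne_zero (mul_ne_zero (mul_ne_zero (pow_ne_zero _ h1) h2) h3) h4

/-- **Membership of `tf α k` in the window `[κ, σ]` at scale `X`**, with the two ratio conditions in
logarithmic form (`N = d² r₀`, `r₀ = p · rad k`, `M⁺ = d⁶ m³`). [folklore] -/
theorem tf_mem_window {κ σ : ℝ} (hp : p.Prime) (hj : j ≠ 0) (hq : (p : ℤ) ^ j = 16 * k + 1)
    (hk : k ≠ 0) (hd : d.Prime) (h5 : 5 ≤ d) (hdp : d ≠ p) (hdk : ¬ d ∣ k)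
    (hα : 4 * α - 1 = d ∨ 4 * α - 1 = -(d : ℤ)) {X : ℝ}
    (hNX : (d : ℝ) ^ 2 * ((p * UniqueFactorizationMonoid.radical k : ℕ) : ℝ) ≤ X)
    (hlo : κ * Real.log ((d : ℝ) ^ 2 * ((p * UniqueFactorizationMonoid.radical k : ℕ) : ℝ)) ≤
      Real.log ((d : ℝ) ^ 6 * ((mOf k : ℕ) : ℝ) ^ 3))
    (hhi : Real.log ((d : ℝ) ^ 6 * ((mOf k : ℕ) : ℝ) ^ 3) ≤
      σ * Real.log ((d : ℝ) ^ 2 * ((p * UniqueFactorizationMonoid.radical k : ℕ) : ℝ))) :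
    tf α (k : ℤ) ∈ windowSet κ σ X := by
  haveI hE := tf_isElliptic hk hd hα
  have hN : ((((tf α (k : ℤ)).baseChange ℚ).conductorNorm ℤ : ℕ) : ℝ) =
      (d : ℝ) ^ 2 * ((p * UniqueFactorizationMonoid.radical k : ℕ) : ℝ) := by
    rw [tf_conductorNorm hp hj hq hk hd h5 hdp hdk hα]; push_cast; ring
  have hM : (((max |(tf α (k : ℤ)).Δ| (|(tf α (k : ℤ)).c₄| ^ 3) : ℤ) : ℝ)) =
      (d : ℝ) ^ 6 * ((mOf k : ℕ) : ℝ) ^ 3 := by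
    rw [tf_maxInv hα]; push_cast; ring
  have hd0 : (0 : ℝ) < d := by exact_mod_cast hd.pos
  have hr0 : (0 : ℝ) < ((p * UniqueFactorizationMonoid.radical k : ℕ) : ℝ) := by
    have : 0 < p * UniqueFactorizationMonoid.radical k := Nat.mul_pos hp.pos (Nat.radical_pos _)
    exact_mod_cast this
  have hB0 : (0 : ℝ) < (d : ℝ) ^ 2 * ((p * UniqueFactorizationMonoid.radical k : ℕ) : ℝ) := by positivity
  have hm0 : (0 : ℝ) < ((mOf k : ℕ) : ℝ) := by exact_mod_cast mOf_pos k
  have hM0 : (0 : ℝ) < (d : ℝ) ^ 6 * ((mOf k : ℕ) : ℝ) ^ 3 := by positivity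
  refine ⟨hE, tf_isMinimalAt hp hq hd hdp hdk hα, Or.inr (tf_a₁ _ _), tf_a₃_mem _ _, tf_a₂_mem _ _,
    tf_c₄_ne_zero hd hα, tf_c₆_ne_zero hk hd hα, ?_, ?_, ?_⟩
  · rw [hN]; exact hNX
  · rw [hN, hM, Real.rpow_def_of_pos hB0, ← Real.exp_log hM0]
    exact Real.exp_le_exp.mpr (by linarith)
  · rw [hN, hM, Real.rpow_def_of_pos hB0, ← Real.exp_log hM0]
    exact Real.exp_le_exp.mpr (by linarith)

end Membership

/-- `αOf d`: the integer `α` with `4α − 1 = ±d`, for odd `d`. [folklore] -/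
def αOf (d : ℕ) : ℤ := if d % 4 = 1 then -(((d : ℤ) - 1) / 4) else ((d : ℤ) + 1) / 4

/-- `4·αOf d − 1 = ±d` for odd `d`. [folklore] -/
theorem αOf_spec {d : ℕ} (hd : d % 2 = 1) : 4 * αOf d - 1 = d ∨ 4 * αOf d - 1 = -(d : ℤ) := by
  unfold αOf
  split_ifs with h <;> omega

/-- The family is injective in `d` (read off `c₄ = d² m`). [folklore] -/
theorem tf_αOf_injOn (k : ℕ) : Set.InjOn (fun d => tf (αOf d) (k : ℤ)) {d : ℕ | d % 2 = 1} := by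
  intro d hd d' hd' h
  have h4 : (tf (αOf d) (k : ℤ)).c₄ = (tf (αOf d') (k : ℤ)).c₄ := by simp only at h; rw [h]
  rw [tf_c₄, tf_c₄, D_sq (αOf_spec hd), D_sq (αOf_spec hd')] at h4
  have hm : (256 * (k : ℤ) ^ 2 + 16 * k + 1) ≠ 0 := by positivity
  have h5 : (d : ℤ) ^ 2 = (d' : ℤ) ^ 2 := mul_right_cancel₀ hm h4
  have h6 : d ^ 2 = d' ^ 2 := by exact_mod_cast h5
  exact Nat.pow_left_injective (by norm_num) h6


/-! #### Preparations for the endgame: residues, exponents, complement count, `log m` -/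

/-- `p` odd ⇒ `p^{4i} ≡ 1 (mod 16)`. [folklore] -/
theorem pow_four_mul_mod_sixteen {p : ℕ} (hp : p % 2 = 1) (i : ℕ) : p ^ (4 * i) % 16 = 1 := by
  have h4 : p ^ 4 % 16 = 1 := by
    have hlt : p % 16 < 16 := Nat.mod_lt _ (by norm_num)
    have hodd : p % 16 % 2 = 1 := by rw [Nat.mod_mod_of_dvd _ (by norm_num)]; exact hp
    rw [Nat.pow_mod]
    interval_cases (p % 16) <;> simp_all
  rw [pow_mul, Nat.pow_mod, h4]; simp

/-- **Exponent bookkeeping.** For `κ ∈ (3,6)` and `0 ≤ δ < (6−κ)/6` there is `j = 4i` with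
`(6−κ) j > κ` and `6δ(j−1) < (6−κ)j − κ` (i.e. `δ < e_j = ((6−κ)j − κ)/(6(j−1))`, equivalently
`(κ−3)/(3(j−1)) < (6−κ)/6 − δ`): then `a = (6j − κ(j+1))/(2κ−6) > 0` and
`γ = a(1−2δ) − (j+1)δ > 0`. [folklore] -/
theorem sixSharp_exponents {κ δ : ℝ} (hκ3 : 3 < κ) (hδ0 : 0 ≤ δ) (hδ : δ < (6 - κ) / 6) :
    ∃ i : ℕ, 1 ≤ i ∧ 0 < 6 * ((4 * i : ℕ) : ℝ) - κ * (((4 * i : ℕ) : ℝ) + 1) ∧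
      0 < (6 * ((4 * i : ℕ) : ℝ) - κ * (((4 * i : ℕ) : ℝ) + 1)) / (2 * κ - 6) * (1 - 2 * δ) -
        (((4 * i : ℕ) : ℝ) + 1) * δ := by
  set g : ℝ := (6 - κ) / 6 - δ with hgdef
  have hg : 0 < g := by rw [hgdef]; linarith
  have h26 : 0 < 2 * κ - 6 := by linarith
  obtain ⟨i, hi⟩ := exists_nat_gt ((κ - 3) / (3 * g) + 2)
  have hi1 : (1 : ℝ) ≤ i := by
    have : 0 ≤ (κ - 3) / (3 * g) := div_nonneg (by linarith) (by linarith)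
    linarith
  refine ⟨i, by exact_mod_cast hi1, ?_, ?_⟩
  all_goals
    set t : ℝ := ((4 * i : ℕ) : ℝ) - 1 with htdef
    have hjt : ((4 * i : ℕ) : ℝ) = t + 1 := by rw [htdef]; ring
    have ht : (κ - 3) < 3 * g * t := by
      have h1 : (κ - 3) / (3 * g) < t := by rw [htdef]; push_cast; linarith
      have h2 := (div_lt_iff₀ (by linarith : (0 : ℝ) < 3 * g)).mp h1
      linarith
    have ht0 : 0 < t := by rw [htdef]; push_cast; linarith
    have key : 6 * δ * t < (6 - κ) * (t + 1) - κ := by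
      have e : g * t = t - κ * t / 6 - δ * t := by rw [hgdef]; ring
      linarith [e, ht]
    have hδt : 0 ≤ 6 * δ * t := by positivity
    rw [hjt]
  · linarith [key]
  · have hnum : 0 < 6 * (t + 1) - κ * (t + 1 + 1) := by linarith [key]
    have e : (2 * κ - 6) * ((6 * (t + 1) - κ * (t + 1 + 1)) / (2 * κ - 6) * (1 - 2 * δ) -
        (t + 1 + 1) * δ) = ((6 - κ) * (t + 1) - κ) - 6 * δ * t := by
      field_simp
      ring
    have h1 : 0 < (2 * κ - 6) * ((6 * (t + 1) - κ * (t + 1 + 1)) / (2 * κ - 6) * (1 - 2 * δ) -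
        (t + 1 + 1) * δ) := by rw [e]; linarith [key]
    rcases (mul_pos_iff.mp h1) with ⟨_, h2⟩ | ⟨h3, _⟩
    · exact h2
    · linarith

/-- Complement count: the primes of `(A, V]` that are `p` or divide `k ≠ 0` are at most `ω(k) + 1`. [folklore] -/
theorem card_primesIoc_le_filter_add {A V p k : ℕ} (hk : k ≠ 0) :
    (primesIoc A V).card ≤ ((primesIoc A V).filter (fun d => d ≠ p ∧ ¬ d ∣ k)).card +
      (k.primeFactors.card + 1) := by
  classical
  have h1 := Finset.card_filter_add_card_filter_not (s := primesIoc A V) (fun d => d ≠ p ∧ ¬ d ∣ k)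
  have h2 : ((primesIoc A V).filter (fun d => ¬ (d ≠ p ∧ ¬ d ∣ k))).card ≤ k.primeFactors.card + 1 := by
    refine le_trans (Finset.card_le_card ?_) (Finset.card_insert_le p k.primeFactors)
    intro d hd
    rw [Finset.mem_filter] at hd
    obtain ⟨hd1, hd2⟩ := hd
    rw [primesIoc, Finset.mem_filter] at hd1
    rw [Finset.mem_insert]
    by_cases hdp : d = p
    · exact Or.inl hdp
    · right
      have : d ∣ k := by by_contra h; exact hd2 ⟨hdp, h⟩
      exact Nat.mem_primeFactors.mpr ⟨hd1.2, this, hk⟩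
  omega

/-- `q²/2 ≤ m ≤ q²` in logarithms, `q = 16k + 1`, `m = mOf k`. [folklore] -/
theorem log_mOf_bounds (k : ℕ) :
    Real.log (mOf k : ℕ) ≤ 2 * Real.log (16 * (k : ℝ) + 1) ∧
      2 * Real.log (16 * (k : ℝ) + 1) ≤ Real.log 2 + Real.log (mOf k : ℕ) := by
  have hk0 : (0 : ℝ) ≤ k := Nat.cast_nonneg k
  have hm0 : (0 : ℝ) < (mOf k : ℕ) := by exact_mod_cast mOf_pos k
  have hq0 : (0 : ℝ) < 16 * (k : ℝ) + 1 := by positivity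
  constructor
  · have h1 : ((mOf k : ℕ) : ℝ) ≤ (16 * (k : ℝ) + 1) ^ 2 := by unfold mOf; push_cast; nlinarith
    have h2 := Real.log_le_log hm0 h1
    rwa [Real.log_pow, Nat.cast_ofNat] at h2
  · have h1 : (16 * (k : ℝ) + 1) ^ 2 ≤ 2 * ((mOf k : ℕ) : ℝ) := by
      unfold mOf; push_cast; nlinarith [sq_nonneg (k : ℝ)]
    have h2 := Real.log_le_log (by positivity) h1
    rwa [Real.log_pow, Nat.cast_ofNat, Real.log_mul (by norm_num) hm0.ne'] at h2

end

end Summit.ABC.ABC.Theorems.ModerateWindowCount.Negative
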